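import Summits.Schanuel.Schanuel.Theorems.RootDecomp1KDarkLogSq01

/-!
# RootDecomp1KDarkLogSq — lens 6, generation 19 «DARK LOG-SQUARE KERNEL ⇒ THE POSITIVE-ORDER LAYER F₊ OF 33364 IS CLOSED AT n = 2» (K-R27 (F₊) lane; input NW96 Thm 1 BY NAME) — continuation (RootDecomp1KDarkLogSq02): §1 THE DARK KERNEL AT LOG-SQUARE QUALITY `logSqMeasure_of_int_relation'` (from NW96 Thm 1 by name)

(lens-6 g19 `DarkLogSq.lean` [HOME/decomp-schanuel-lens-6/g19/ sha256 81ff816b…, 1170 l; NODE L1934 / REQUEST L1935; critic VERDICT L1938 (K-R27 (F₊) cell credit, port GO)]; port by census-1 gen 17 as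
`RootDecomp1KDarkLogSq01`–`06` — see the PORT NOTE of part 01; `--supports stmt-Schanuel-33364`; rung 0.)
-/

noncomputable section

open Complex IntermediateField Filter Polynomial
open Literature.NumberTheory.Transcendental (NesterenkoWaldschmidt1996_thm_1)
open Summit.Schanuel.Schanuel.Theorems.RootDecomp1KHyper
open Summit.Schanuel.Schanuel.Theorems.RootDecomp1KHyper.HyperCell
open Summit.Schanuel.Schanuel.Theorems.RootDecomp1KGeneric (LiouvilleOrder LogSqLiouville sb_two_of_ordRatio
  sb_two_of_lowOrderResidual)
open Summit.Schanuel.Schanuel.Theorems.RootDecomp1KRelLiouvilleCell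

namespace Summit.Schanuel.Schanuel.Theorems.RootDecomp1KDarkLogSq

/-- `1 ≤ M(R)` for a non-zero integer polynomial `R` (Mahler measure over `ℂ`). -/
private theorem one_le_mahlerMeasure_map_of_ne_zero {R : ℤ[X]} (hR : R ≠ 0) :
    1 ≤ (R.map (Int.castRingHom ℂ)).mahlerMeasure := by
  refine one_le_mahlerMeasure_of_one_le_norm_leadingCoeff ?_
  rw [Polynomial.leadingCoeff_map_of_injective (RingHom.injective_int _), eq_intCast,
    Complex.norm_intCast]
  exact_mod_cast Int.one_le_abs (Polynomial.leadingCoeff_ne_zero.mpr hR)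

/-- Mahler measure is monotone along divisibility of integer polynomials: `Q ∣ A`, `A ≠ 0` ⇒ `M(Q) ≤ M(A)`. -/
private theorem mahlerMeasure_le_of_dvd {Q A : ℤ[X]} (hdvd : Q ∣ A) (hA : A ≠ 0) :
    (Q.map (Int.castRingHom ℂ)).mahlerMeasure ≤ (A.map (Int.castRingHom ℂ)).mahlerMeasure := by
  obtain ⟨R, rfl⟩ := hdvd
  have hR : R ≠ 0 := right_ne_zero_of_mul hA
  rw [Polynomial.map_mul, mahlerMeasure_mul]
  calc (Q.map (Int.castRingHom ℂ)).mahlerMeasure = (Q.map (Int.castRingHom ℂ)).mahlerMeasure * 1 :=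
        (mul_one _).symm
    _ ≤ _ := mul_le_mul_of_nonneg_left (one_le_mahlerMeasure_map_of_ne_zero hR)
        (mahlerMeasure_nonneg _)

open Literature.NumberTheory.Transcendental in
set_option maxHeartbeats 800000 in
/-- **THE LOG-SQUARE DARK KERNEL (mod NW 1996 Theorem 1).**  An exponential-algebraic point `t ≠ 0` — an integer
polynomial relation `Σ_{k ≤ K} G_k(t) e^{kt} = 0` with `K ≥ 1` and `G_K(t) ≠ 0` — has a `LogSqMeasure`.
Proof = the TREE proof of `HyperCell.weakMeasure_of_int_relation'` (RootDecomp1KDarkKernel) VERBATIM except for the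
bookkeeping variable: the heights enter NW96 Theorem 1 through `h(β) ≤ log M(f) ≤ log Λ` and `h(α) ≤ log M(S) ≤ d·log L + N·log Λ`
(`Λ = len P`, `L` = length of the relation, `S` the eliminant), so the exponent is `≤ C_Φ·Λ'²` with `Λ' := 1 + log Λ`
(the tree bounds `log Λ ≤ Λ` at this point and concludes `C·Λ²`). -/
theorem logSqMeasure_of_int_relation' (hNW : NesterenkoWaldschmidt1996_thm_1) {t : ℂ} (ht0 : t ≠ 0)
    {K : ℕ} (hK : 0 < K) (G : Fin (K + 1) → ℤ[X]) (hGKt : aeval t (G (Fin.last K)) ≠ 0)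
    (hrel : ∑ k : Fin (K + 1), aeval t (G k) * cexp t ^ (k : ℕ) = 0) : LogSqMeasure t := by
  classical
  have hGK : G (Fin.last K) ≠ 0 := fun h => hGKt (by rw [h, map_zero])
  obtain ⟨N, hN⟩ : ∃ N : ℕ, ∀ k, (G k).natDegree ≤ N :=
    ⟨Finset.univ.sup fun k => (G k).natDegree, fun k =>
      Finset.le_sup (f := fun k => (G k).natDegree) (Finset.mem_univ k)⟩
  obtain ⟨L, hLdef⟩ : ∃ L : ℝ, L = relLen G := ⟨_, rfl⟩
  have hL1 : 1 ≤ L := hLdef ▸ one_le_relLen G hGK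
  have hL0 : 0 < L := zero_lt_one.trans_le hL1
  have hlogL : 0 ≤ Real.log L := Real.log_nonneg hL1
  -- Lipschitz data at `t`
  have hRt : (sliceAt G (cexp t)).eval t = 0 := by rw [eval_sliceAt]; exact hrel
  obtain ⟨MR, hMR1, hMR⟩ := exists_lipschitz_at_croot (sliceAt G (cexp t)) t hRt
  obtain ⟨MG, hMG1, hMG⟩ := exists_lipschitz_at ((G (Fin.last K)).map (Int.castRingHom ℂ)) t
  have hMR0 : 0 < MR := zero_lt_one.trans_le hMR1
  have hMG0 : 0 < MG := zero_lt_one.trans_le hMG1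
  set g0 : ℝ := ‖aeval t (G (Fin.last K))‖ / 2 with hg0def
  have hg0 : 0 < g0 := by rw [hg0def]; exact half_pos (norm_pos_iff.mpr hGKt)
  set ct : ℝ := MR / g0 + 1 with hctdef
  have hct1 : 1 ≤ ct := by
    rw [hctdef]; exact le_add_of_nonneg_left (div_nonneg hMR0.le hg0.le)
  have hct0 : 0 < ct := zero_lt_one.trans_le hct1
  have hlogct : 0 ≤ Real.log ct := Real.log_nonneg hct1
  have het0 : 0 < ‖cexp t‖ := norm_pos_iff.mpr (Complex.exp_ne_zero t)
  set δ : ℝ := min 1 (min (‖t‖ / 2) (min (g0 / MG) (‖cexp t‖ ^ K / (2 * ct)))) with hδdef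
  have hδ0 : 0 < δ := by
    rw [hδdef]
    refine lt_min one_pos (lt_min (half_pos (norm_pos_iff.mpr ht0)) (lt_min (div_pos hg0 hMG0) ?_))
    exact div_pos (pow_pos het0 K) (by positivity)
  have hδ1 : δ ≤ 1 := min_le_left _ _
  have hδt : δ ≤ ‖t‖ / 2 := (min_le_right _ _).trans (min_le_left _ _)
  have hδG : δ ≤ g0 / MG := ((min_le_right _ _).trans (min_le_right _ _)).trans (min_le_left _ _)
  have hδe : δ ≤ ‖cexp t‖ ^ K / (2 * ct) :=
    ((min_le_right _ _).trans (min_le_right _ _)).trans (min_le_right _ _)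
  set ℓt : ℝ := Real.log (Real.exp 1 * max 1 ‖t‖) with hℓtdef
  have hℓt : 0 ≤ ℓt := by
    rw [hℓtdef]
    refine Real.log_nonneg ?_
    have h1 : (1 : ℝ) ≤ Real.exp 1 := by linarith [Real.add_one_le_exp (1 : ℝ)]
    exact one_le_mul_of_one_le_of_one_le h1 (le_max_left _ _)
  intro d
  -- the constants for degree `d`
  set ε0 : ℝ := δ ^ d with hε0def
  have hε0pos : 0 < ε0 := pow_pos hδ0 d
  have hε01 : ε0 ≤ 1 := pow_le_one₀ hδ0.le hδ1
  have hlogε0 : Real.log ε0 ≤ 0 := Real.log_nonpos hε0pos.le hε01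
  set D0 : ℝ := ((d * d * K : ℕ) : ℝ) with hD0def
  have hD0 : 0 ≤ D0 := Nat.cast_nonneg _
  have hlogD0 : 0 ≤ Real.log D0 := Real.log_natCast_nonneg _
  have hlogD02 : 0 ≤ Real.log (D0 + 2) := Real.log_nonneg (by linarith only [hD0])
  set a1 : ℝ := d * Real.log L + N + 1 with ha1def
  have ha1 : 0 ≤ a1 := by rw [ha1def]; positivity
  set F1 : ℝ := 2 + a1 + 4 * Real.log D0 + 2 * ℓt + 10 with hF1def
  have hF1 : 0 ≤ F1 := by rw [hF1def]; positivity
  set F2 : ℝ := D0 * a1 + 2 * Real.exp 1 * ‖t‖ + 6 with hF2def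
  have hF2 : 0 ≤ F2 := by rw [hF2def]; positivity
  set F3 : ℝ := 33 / 10 * D0 * Real.log (D0 + 2) + 1 with hF3def
  have hF3 : 0 ≤ F3 := by rw [hF3def]; positivity
  set CΦ : ℝ := 211 * D0 * F1 * F2 * F3 with hCΦdef
  have hCΦ : 0 ≤ CΦ := by rw [hCΦdef]; positivity
  have hlog2 : 0 < Real.log 2 := Real.log_pos (by norm_num)
  set Cw : ℝ := d * K * CΦ + d * K * Real.log 2 + d * Real.log ct - Real.log ε0 + 1 with hCdef
  have hCK : 0 ≤ d * K * CΦ + d * K * Real.log 2 + d * Real.log ct := by positivity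
  have hC1 : 1 - Real.log ε0 ≤ Cw := by rw [hCdef]; linarith only [hCK]
  have hCpos : 0 < Cw := by linarith only [hC1, hlogε0]
  refine ⟨Cw, hCpos, fun P hP0 hPd => ?_⟩
  set Λ : ℝ := ((len P : ℤ) : ℝ) with hΛdef
  have hΛ1 : 1 ≤ Λ := by rw [hΛdef]; exact_mod_cast one_le_len hP0
  have hΛ0 : 0 < Λ := zero_lt_one.trans_le hΛ1
  have hlogΛ : 0 ≤ Real.log Λ := Real.log_nonneg hΛ1
  -- THE bookkeeping variable: Λ' = 1 + log Λ (the tree uses Λ itself here)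
  set Λ' : ℝ := 1 + Real.log Λ with hΛ'def
  have hΛ'1 : 1 ≤ Λ' := by rw [hΛ'def]; linarith only [hlogΛ]
  have hΛ'0 : 0 < Λ' := zero_lt_one.trans_le hΛ'1
  have hΛ'2 : 1 ≤ Λ' ^ 2 := one_le_pow₀ hΛ'1
  set ε : ℝ := ‖aeval t P‖ with hεdef
  by_cases hsmall : ε < ε0
  swap
  · -- the trivial range `|P(t)| ≥ ε₀`
    have hge : ε0 ≤ ε := not_lt.mp hsmall
    calc Real.exp (-(Cw * Λ' ^ 2)) ≤ Real.exp (-Cw) := by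
          rw [Real.exp_le_exp]
          have : Cw * 1 ≤ Cw * Λ' ^ 2 := mul_le_mul_of_nonneg_left hΛ'2 hCpos.le
          linarith only [this]
      _ ≤ Real.exp (Real.log ε0) := by rw [Real.exp_le_exp]; linarith only [hC1]
      _ = ε0 := Real.exp_log hε0pos
      _ ≤ ε := hge
  -- the small range: `P` is non-constant
  have hPdeg : 0 < P.natDegree := by
    by_contra h
    have h0 : P.natDegree = 0 := by omega
    have hPC : P = C (P.coeff 0) := eq_C_of_natDegree_eq_zero h0
    have hc0 : P.coeff 0 ≠ 0 := by
      intro hc; apply hP0; rw [hPC, hc, C_0]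
    have h1 : (1 : ℝ) ≤ ε := by
      rw [hεdef, hPC, aeval_C, algebraMap_int_eq, eq_intCast, Complex.norm_intCast]
      exact_mod_cast Int.one_le_abs hc0
    linarith only [h1, hsmall, hε01]
  -- a root `β` of `P` near `t`
  obtain ⟨β, hβP, hβclose⟩ := exists_root_int_pow_le P hPdeg t
  set ρ : ℝ := ‖t - β‖ with hρdef
  have hρ0 : 0 ≤ ρ := norm_nonneg _
  have hρδ : ρ < δ := by
    have h1 : ρ ^ P.natDegree < δ ^ P.natDegree :=
      calc ρ ^ P.natDegree ≤ ε := hβclose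
        _ < ε0 := hsmall
        _ = δ ^ d := rfl
        _ ≤ δ ^ P.natDegree := pow_le_pow_of_le_one hδ0.le hδ1 hPd
    exact lt_of_pow_lt_pow_left₀ _ hδ0.le h1
  have hρ1 : ρ ≤ 1 := (hρδ.le.trans hδ1)
  have hρ' : ‖β - t‖ = ρ := by rw [hρdef, norm_sub_rev]
  -- `β ≠ 0`
  have hβ0 : β ≠ 0 := by
    rintro rfl
    have : ‖t‖ < δ := by simpa [hρdef] using hρδ
    linarith only [this, hδt, norm_pos_iff.mpr ht0]
  -- `G_K(β) ≠ 0`, quantitatively `‖G_K(β)‖ ≥ g0`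
  have hGKβ_ge : g0 ≤ ‖aeval β (G (Fin.last K))‖ := by
    have h1 := hMG β (by rw [hρ']; exact hρ1)
    rw [eval_map_int, eval_map_int, hρ'] at h1
    have h2 : MG * ρ ≤ g0 := by
      calc MG * ρ ≤ MG * δ := mul_le_mul_of_nonneg_left hρδ.le hMG0.le
        _ ≤ MG * (g0 / MG) := mul_le_mul_of_nonneg_left hδG hMG0.le
        _ = g0 := by field_simp
    have h3 : ‖aeval t (G (Fin.last K))‖ = 2 * g0 := by rw [hg0def]; ring
    have h4 := norm_sub_norm_le (aeval t (G (Fin.last K))) (aeval β (G (Fin.last K)))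
    rw [← norm_neg, neg_sub] at h1
    linarith only [h1, h2, h3, h4]
  have hGKβ : aeval β (G (Fin.last K)) ≠ 0 := by
    intro h; rw [h, norm_zero] at hGKβ_ge; linarith only [hGKβ_ge, hg0]
  -- the irreducible factor `f` of `P` at `β`
  have hβalgP : IsAlgebraic ℚ β := isAlgebraic_of_aeval_int hP0 hβP
  obtain ⟨f, hfirr, hfdeg, hβf⟩ := NesterenkoWaldschmidt1996.exists_irreducible_int_aeval_eq_zero hβalgP
  have hf0 : f ≠ 0 := hfirr.ne_zero
  have hfP : f ∣ P := dvd_of_irreducible_of_common_root hfirr hfdeg hβf hβP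
  have hnP : f.natDegree ≤ P.natDegree := natDegree_le_of_dvd hfP hP0
  have hnd : f.natDegree ≤ d := hnP.trans hPd
  set Mf : ℝ := (f.map (Int.castRingHom ℂ)).mahlerMeasure with hMfdef
  have hMf1 : 1 ≤ Mf := one_le_mahlerMeasure_map_of_ne_zero hf0
  have hMfΛ : Mf ≤ Λ := by
    refine (mahlerMeasure_le_of_dvd hfP hP0).trans ((mahlerMeasure_map_le_sum le_rfl).trans ?_)
    rw [hΛdef, len]; push_cast; exact le_rfl
  -- `G_K` vanishes at no conjugate of `β`
  have hconj : ∀ b ∈ (f.map (Int.castRingHom ℂ)).roots, aeval b (G (Fin.last K)) ≠ 0 := by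
    intro b hb h0
    have hbf : aeval b f = 0 := by
      have := (mem_roots ((Polynomial.map_ne_zero_iff (RingHom.injective_int _)).mpr hf0)).mp hb
      rwa [IsRoot.def, eval_map, ← algebraMap_int_eq, ← aeval_def] at this
    obtain ⟨R, hR⟩ := dvd_of_irreducible_of_common_root hfirr hfdeg hbf h0
    apply hGKβ
    rw [hR, map_mul, hβf, zero_mul]
  -- the eliminant `S` and the root `α` of `Q(β, ·)` near `e^t`
  obtain ⟨S, hSdef⟩ : ∃ S : ℤ[X], S = resPoly f G N := ⟨_, rfl⟩
  have hS0 : S ≠ 0 := hSdef ▸ resPoly_ne_zero f hf0 G hN hconj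
  obtain ⟨α, hαroot, hαle⟩ := exists_root_conjFactor_pow_le G hK hGKβ (cexp t)
  have hSα : aeval α S = 0 := hSdef ▸ aeval_resPoly_eq_zero f hf0 G hN hβf hαroot
  have hαK : ‖cexp t - α‖ ^ K ≤ ct * ρ := by
    have h1 : ‖(conjFactor G β).eval (cexp t)‖ ≤ MR * ρ := by
      rw [eval_conjFactor_eq_eval_sliceAt, ← hρ']
      exact hMR β (by rw [hρ']; exact hρ1)
    have h2 : g0 * ‖cexp t - α‖ ^ K ≤ MR * ρ :=
      (mul_le_mul_of_nonneg_right hGKβ_ge (pow_nonneg (norm_nonneg _) K)).trans (hαle.trans h1)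
    have h3 : ‖cexp t - α‖ ^ K ≤ MR / g0 * ρ := by
      rw [div_mul_eq_mul_div, le_div_iff₀ hg0]; linarith only [h2]
    calc ‖cexp t - α‖ ^ K ≤ MR / g0 * ρ := h3
      _ ≤ ct * ρ := mul_le_mul_of_nonneg_right (by rw [hctdef]; exact le_add_of_nonneg_right zero_le_one) hρ0
  have hα0 : α ≠ 0 := by
    rintro rfl
    have h1 : ‖cexp t - 0‖ ^ K < ‖cexp t‖ ^ K :=
      calc ‖cexp t - 0‖ ^ K ≤ ct * ρ := hαK
        _ ≤ ct * δ := mul_le_mul_of_nonneg_left hρδ.le hct0.le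
        _ ≤ ct * (‖cexp t‖ ^ K / (2 * ct)) := mul_le_mul_of_nonneg_left hδe hct0.le
        _ = ‖cexp t‖ ^ K / 2 := by field_simp
        _ < ‖cexp t‖ ^ K := half_lt_self (pow_pos het0 K)
    rw [sub_zero] at h1
    exact lt_irrefl _ h1
  -- degrees and heights
  obtain ⟨hαalg, hβalg, hD1, hDle, hhα, hhβ⟩ := pair_bounds f hfirr hfdeg hβf S hS0 hSα
  obtain ⟨D, hDdef⟩ : ∃ D : ℕ, Module.finrank ℚ (IntermediateField.adjoin ℚ ({α, β} : Set ℂ)) = D :=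
    ⟨_, rfl⟩
  rw [hDdef] at hD1 hDle
  have hD1' : (1 : ℝ) ≤ D := by exact_mod_cast hD1
  have hD0' : (0 : ℝ) < D := zero_lt_one.trans_le hD1'
  have hDD0 : (D : ℝ) ≤ D0 := by
    rw [hD0def]
    have h1 : D ≤ d * d * K := by
      refine hDle.trans ?_
      calc S.natDegree * f.natDegree ≤ (f.natDegree * K) * f.natDegree :=
            Nat.mul_le_mul_right _ (hSdef ▸ natDegree_resPoly_le f G hN)
        _ ≤ (d * K) * d := Nat.mul_le_mul (Nat.mul_le_mul_right _ hnd) hnd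
        _ = d * d * K := by ring
    exact_mod_cast h1
  have hlogD : 0 ≤ Real.log (D : ℝ) := Real.log_nonneg hD1'
  have hlogDD0 : Real.log (D : ℝ) ≤ Real.log D0 := Real.log_le_log hD0' hDD0
  have hlogD2 : Real.log ((D : ℝ) + 2) ≤ Real.log (D0 + 2) :=
    Real.log_le_log (by positivity) (by linarith only [hDD0])
  set MS : ℝ := (S.map (Int.castRingHom ℂ)).mahlerMeasure with hMSdef
  have hMS1 : 1 ≤ MS := one_le_mahlerMeasure_map_of_ne_zero hS0
  have hMf0 : 0 ≤ Mf := zero_le_one.trans hMf1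
  have hMSle : MS ≤ L ^ d * Λ ^ N := by
    rw [hMSdef, hSdef]
    refine (mahlerMeasure_resPoly_le f hf0 G hN).trans ?_
    rw [← hLdef, ← hMfdef]
    exact mul_le_mul (pow_le_pow_right₀ hL1 hnd) (pow_le_pow_left₀ hMf0 hMfΛ N)
      (pow_nonneg hMf0 N) (pow_nonneg hL0.le d)
  set a : ℝ := Real.log MS + 1 with hadef
  have ha1' : 1 ≤ a := by rw [hadef]; linarith [Real.log_nonneg hMS1]
  have ha0 : 0 < a := by linarith
  -- HERE is the log-square bookkeeping: `a ≤ a1 · Λ'` with `Λ' = 1 + log Λ` (tree: `a ≤ a1 · Λ`)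
  have haΛ : a ≤ a1 * Λ' := by
    have h1 : Real.log MS ≤ d * Real.log L + N * Real.log Λ := by
      rw [← Real.log_pow, ← Real.log_pow, ← Real.log_mul (pow_pos hL0 d).ne' (pow_pos hΛ0 N).ne']
      exact Real.log_le_log (zero_lt_one.trans_le hMS1) hMSle
    have h3 : (N : ℝ) * Real.log Λ ≤ N * Λ' := by
      refine mul_le_mul_of_nonneg_left ?_ (Nat.cast_nonneg N)
      rw [hΛ'def]; linarith only []
    have h4 : (d : ℝ) * Real.log L * 1 ≤ d * Real.log L * Λ' :=
      mul_le_mul_of_nonneg_left hΛ'1 (by positivity)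
    have e : a1 * Λ' = d * Real.log L * Λ' + N * Λ' + Λ' := by rw [ha1def]; ring
    rw [hadef, e]
    linarith only [h1, h3, h4, hΛ'1]
  have hloga : Real.log a ≤ a := (Real.log_le_sub_one_of_pos ha0).trans (by linarith only [])
  set b : ℝ := Real.log Mf + 1 with hbdef
  -- and `b ≤ 2 · Λ'` (tree: `b ≤ 2 · Λ`); in fact `b ≤ Λ'`
  have hbΛ : b ≤ 2 * Λ' := by
    have h1 : Real.log Mf ≤ Real.log Λ := Real.log_le_log (zero_lt_one.trans_le hMf1) hMfΛ
    rw [hbdef, hΛ'def]; linarith only [h1, hlogΛ]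
  have hb0 : 0 ≤ b := by rw [hbdef]; linarith only [Real.log_nonneg hMf1]
  -- the hypotheses of Theorem 1
  have hA : max (weilHeight₁ (IntermediateField.adjoin ℚ ({α, β} : Set ℂ)) (fun _ : Unit => α))
      (1 / (Module.finrank ℚ (IntermediateField.adjoin ℚ ({α, β} : Set ℂ)) : ℝ)) ≤
      Real.log (Real.exp a) := by
    rw [Real.log_exp, hDdef]
    refine max_le (hhα.trans (by rw [hadef]; exact le_add_of_nonneg_right zero_le_one)) ?_
    calc (1 : ℝ) / D ≤ 1 := by rw [div_le_one hD0']; exact hD1'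
      _ ≤ a := ha1'
  have hB : weilHeight₁ (IntermediateField.adjoin ℚ ({α, β} : Set ℂ)) (fun _ : Unit => β) ≤
      Real.log (Real.exp b) := by
    rw [Real.log_exp, hbdef]
    refine hhβ.trans ?_
    rw [hMfdef]; exact le_add_of_nonneg_right zero_le_one
  -- Theorem 1 at `θ = t`
  have key : Real.exp (-(211 * (D : ℝ) * (b + Real.log a + 4 * Real.log (D : ℝ) + 2 * ℓt + 10) *
      ((D : ℝ) * a + 2 * Real.exp 1 * ‖t‖ + 6 * 1) *
      ((33 / 10 : ℝ) * (D : ℝ) * Real.log ((D : ℝ) + 2) + 1) / 1 ^ 2)) ≤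
      ‖cexp t - α‖ + ‖t - β‖ := by
    have h := hNW t α β (Real.exp a) (Real.exp b) (Real.exp 1) ht0 hα0 hβ0 hαalg hβalg
      (Real.exp_pos a) (Real.exp_pos b) le_rfl hA hB
    rw [Real.log_exp, Real.log_exp, Real.log_exp, hDdef] at h
    exact h
  -- the exponent is at most `CΦ Λ'²`
  set Φ : ℝ := 211 * (D : ℝ) * (b + Real.log a + 4 * Real.log (D : ℝ) + 2 * ℓt + 10) *
      ((D : ℝ) * a + 2 * Real.exp 1 * ‖t‖ + 6 * 1) *
      ((33 / 10 : ℝ) * (D : ℝ) * Real.log ((D : ℝ) + 2) + 1) / 1 ^ 2 with hΦdef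
  have hf1le : b + Real.log a + 4 * Real.log (D : ℝ) + 2 * ℓt + 10 ≤ F1 * Λ' := by
    have h1 : Real.log a ≤ a1 * Λ' := hloga.trans haΛ
    have h2 : 4 * Real.log (D : ℝ) * 1 ≤ 4 * Real.log D0 * Λ' :=
      mul_le_mul (by linarith only [hlogDD0]) hΛ'1 zero_le_one (by positivity)
    have h3 : 2 * ℓt * 1 ≤ 2 * ℓt * Λ' := mul_le_mul_of_nonneg_left hΛ'1 (by positivity)
    have e : F1 * Λ' = 2 * Λ' + a1 * Λ' + 4 * Real.log D0 * Λ' + 2 * ℓt * Λ' + 10 * Λ' := by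
      rw [hF1def]; ring
    rw [e]
    linarith only [hbΛ, h1, h2, h3, hΛ'1]
  have hf1nn : 0 ≤ b + Real.log a + 4 * Real.log (D : ℝ) + 2 * ℓt + 10 := by
    have : 0 ≤ Real.log a := Real.log_nonneg ha1'
    positivity
  have hf2le : (D : ℝ) * a + 2 * Real.exp 1 * ‖t‖ + 6 * 1 ≤ F2 * Λ' := by
    have h1 : (D : ℝ) * a ≤ D0 * (a1 * Λ') := mul_le_mul hDD0 haΛ ha0.le hD0
    have h2 : (2 * Real.exp 1 * ‖t‖ + 6) * 1 ≤ (2 * Real.exp 1 * ‖t‖ + 6) * Λ' :=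
      mul_le_mul_of_nonneg_left hΛ'1 (by positivity)
    have e : F2 * Λ' = D0 * (a1 * Λ') + (2 * Real.exp 1 * ‖t‖ + 6) * Λ' := by rw [hF2def]; ring
    rw [e]
    linarith only [h1, h2]
  have hf2nn : 0 ≤ (D : ℝ) * a + 2 * Real.exp 1 * ‖t‖ + 6 * 1 := by positivity
  have hf3le : (33 / 10 : ℝ) * (D : ℝ) * Real.log ((D : ℝ) + 2) + 1 ≤ F3 := by
    rw [hF3def]
    have : (33 / 10 : ℝ) * (D : ℝ) * Real.log ((D : ℝ) + 2) ≤ 33 / 10 * D0 * Real.log (D0 + 2) :=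
      mul_le_mul (mul_le_mul_of_nonneg_left hDD0 (by norm_num)) hlogD2
        (Real.log_nonneg (by linarith only [hD1'])) (by positivity)
    linarith only [this]
  have hf3nn : 0 ≤ (33 / 10 : ℝ) * (D : ℝ) * Real.log ((D : ℝ) + 2) + 1 := by
    have : 0 ≤ Real.log ((D : ℝ) + 2) := Real.log_nonneg (by linarith only [hD1'])
    positivity
  have hΦle : Φ ≤ CΦ * Λ' ^ 2 := by
    rw [hΦdef, hCΦdef, one_pow, div_one]
    calc 211 * (D : ℝ) * (b + Real.log a + 4 * Real.log (D : ℝ) + 2 * ℓt + 10) *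
          ((D : ℝ) * a + 2 * Real.exp 1 * ‖t‖ + 6 * 1) *
          ((33 / 10 : ℝ) * (D : ℝ) * Real.log ((D : ℝ) + 2) + 1)
        ≤ 211 * D0 * (F1 * Λ') * (F2 * Λ') * F3 := by
          refine mul_le_mul (mul_le_mul (mul_le_mul (mul_le_mul_of_nonneg_left hDD0 (by norm_num))
            hf1le hf1nn (by positivity)) hf2le hf2nn (by positivity)) hf3le hf3nn (by positivity)
      _ = 211 * D0 * F1 * F2 * F3 * Λ' ^ 2 := by ring
  have hΦ0 : 0 ≤ Φ := by rw [hΦdef]; positivity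
  -- endgame: `ρ ≥ (η/2)^K / ct`, `ε ≥ ρ^d`
  set η : ℝ := Real.exp (-Φ) with hηdef
  have hη0 : 0 < η := Real.exp_pos _
  have hη1 : η ≤ 1 := by rw [hηdef, Real.exp_le_one_iff]; linarith only [hΦ0]
  have hkey : η ≤ ‖cexp t - α‖ + ρ := key
  have hη2 : 0 ≤ η / 2 := by linarith only [hη0]
  have hρlb : (η / 2) ^ K / ct ≤ ρ := by
    rcases le_or_gt (η / 2) ρ with h | h
    · calc (η / 2) ^ K / ct ≤ (η / 2) ^ K := div_le_self (pow_nonneg hη2 K) hct1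
        _ ≤ η / 2 := pow_le_of_le_one hη2 (by linarith only [hη1]) hK.ne'
        _ ≤ ρ := h
    · have h1 : η / 2 ≤ ‖cexp t - α‖ := by linarith only [h, hkey]
      have h2 : (η / 2) ^ K ≤ ct * ρ := (pow_le_pow_left₀ hη2 h1 K).trans hαK
      rw [div_le_iff₀ hct0]; linarith only [h2]
  have hr0 : 0 < (η / 2) ^ K / ct := div_pos (pow_pos (half_pos hη0) K) hct0
  have hεlb : ((η / 2) ^ K / ct) ^ d ≤ ε :=
    calc ((η / 2) ^ K / ct) ^ d ≤ ρ ^ d := pow_le_pow_left₀ hr0.le hρlb d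
      _ ≤ ρ ^ P.natDegree := pow_le_pow_of_le_one hρ0 hρ1 hPd
      _ ≤ ε := hβclose
  refine le_trans ?_ hεlb
  rw [← Real.exp_log (pow_pos hr0 d), Real.exp_le_exp, Real.log_pow, Real.log_div
    (pow_pos (half_pos hη0) K).ne' hct0.ne', Real.log_pow, Real.log_div hη0.ne' two_ne_zero, hηdef,
    Real.log_exp]
  -- `-(C Λ'²) ≤ d (K (−Φ − log 2) − log ct)`
  have h1 : (d : ℝ) * K * Φ ≤ d * K * (CΦ * Λ' ^ 2) := mul_le_mul_of_nonneg_left hΦle (by positivity)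
  have h2 : (d : ℝ) * K * Real.log 2 * 1 ≤ d * K * Real.log 2 * Λ' ^ 2 :=
    mul_le_mul_of_nonneg_left hΛ'2 (by positivity)
  have h3 : (d : ℝ) * Real.log ct * 1 ≤ d * Real.log ct * Λ' ^ 2 :=
    mul_le_mul_of_nonneg_left hΛ'2 (by positivity)
  have h4 : 0 ≤ (-Real.log ε0 + 1) * Λ' ^ 2 := mul_nonneg (by linarith only [hlogε0]) (by positivity)
  have hCΛ : Cw * Λ' ^ 2 = d * K * (CΦ * Λ' ^ 2) + d * K * Real.log 2 * Λ' ^ 2 +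
      d * Real.log ct * Λ' ^ 2 + (-Real.log ε0 + 1) * Λ' ^ 2 := by rw [hCdef]; ring
  linarith only [hCΛ, h1, h2, h3, h4]

end Summit.Schanuel.Schanuel.Theorems.RootDecomp1KDarkLogSq

end
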